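import Literature.Probability.LatticeModels.FieldCurrentsTheta
import Literature.Probability.LatticeModels.MeanFieldDifferentialInequality
import HarnessLib

/-!
# Conditioning random currents on clusters: the lexicon of Aizenman–Fernández 1986, §3.3–3.4 and §5.1

Topic `Probability/LatticeModels`, namespace `Literature.Probability.LatticeModels`. Second layer of
the proof of the Aizenman–Fernández differential inequalities (J. Stat. Phys. 44 (1986) 393–454,
Theorems 5.6–5.7) for the `θ`-system of `FieldCurrentsTheta` (couplings `θ ≥ 0` on the edges
`ℰ⁺_Λ` of the ghost graph, state `thetaCorr G Λ θ`, current pair sums `currentPairSum G Λ θ X Y F`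
of `MeanFieldDifferentialInequality`).

Aizenman–Fernández's two "basic techniques" (§3.3) are the switching lemma (in the tree:
`currentPairSum_switching`) and **conditioning over clusters** (Lemmas 3.2–3.3, eq. (3.10)–(3.11):
"conditioning over the cluster `C(p)` and, for each such cluster, summing independently over the
current configurations inside and outside the cluster. The latter gives the expectation of `σ_B`
in a less ferromagnetic system which has been deprived of all the bonds in `C(p)`"). The tree's
`currentPairSum_clusterCompl_eq` is the factorisation on the event `𝒮_b = S` (`𝒮_b` the set of
vertices of `Λ ∪ {g}` not connected to `b`, i.e. the complement of the vertex cluster of `b`).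
This file turns it into the working lexicon ("lexicon", ibid. §3.1 (iii)) used in §5:

* `currentPairSum_clusterCompl_strip` — **Lemma 3.3 in stripped form**: on `{𝒮_b = S}` the sources
  inside `S` come out as the depleted current sums `Z_S(X ∩ S) Z_S(Y ∩ S)`;
* `clusterWeight θ o x S = Z⁻² ∑_{∂n₁ = ({o}∆{x})*, ∂n₂ = ∅} w w 𝟙[𝒮_o = S]` (real, `≥ 0`) — the
  law of the cluster of `o` in the double current with sources `{o} ∆ {x}` (the weights
  `W(n₁)W(n₂)/Z² 𝟙[…]` of (3.12)–(3.16)), and `corrIn θ S A = ⟨σ_A⟩_S` — the correlation of the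
  system deprived of all bonds not inside `S` (`⟨σ_B⟩_{C_{n₁+n₂}(x)^c}`);
* `thetaCorr_pair_sub_eq_sum_clusterWeight` — **(3.15)**:
  `⟨σ_oσ_x⟩ - ⟨σ_o⟩⟨σ_x⟩ = ∑_{S ∋ g} clusterWeight o x S` ("`⟨σ_x;σ_y⟩ = ∑ 𝟙[x ↮ h]`");
* `dctDelta_toReal_eq_sum` and `thetaCorr_triple_sub_eq_sum` — **(3.13) and (3.16)**:
  `⟨σ_oσ_xσ_y⟩ - ⟨σ_o⟩⟨σ_xσ_y⟩ = ∑_{S ∋ g,y; ∌ o,x} clusterWeight o x S ⟨σ_y⟩_S + (x ⇄ y)`;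
* `hclusterWeight θ S'` (`= Z⁻² W(S')` of `MeanFieldDifferentialInequality.dctW`) — the law of
  `𝒮_g` under the duplicated sourceless measure, and `pairSum_hcluster_eq_sum` — **Lemma 5.1,
  eq. (5.1)**: `Z⁻² ∑_{∂n₁ = A, ∂n₂ = B} w w 𝟙[A ∪ B ↮ g] = ∑_{S'} hclusterWeight S' ⟨σ_A⟩_{S',0} ⟨σ_B⟩_{S',0}`
  for pairs `A`, `B`, with **(5.3)** `∑_{S'} hclusterWeight S' ⟨σ_oσ_x⟩_{S',0} = ⟨σ_o;σ_x⟩`;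
* `pairSum_conn_toReal_eq` — the three-point switching identity
  `Z⁻² ∑_{∂n₁ = ({x}∆{u})*, ∂n₂ = ∅} w w 𝟙[x ⟷ l] = ⟨σ_uσ_l⟩⟨σ_xσ_l⟩` (used in Lemma 5.4).

Everything is proved; there are no named facts. All statements are for an arbitrary locally
finite graph `G`, finite volume `Λ` and couplings `θ ≥ 0`.

## References

* M. Aizenman, R. Fernández, J. Stat. Phys. 44 (1986) 393–454: §3.3 (Lemmas 3.1–3.3,
  eqs. (3.8)–(3.11)), §3.4 (Prop. 3.4, Cor. 3.5, eqs. (3.12)–(3.16)), §5.1 (Lemma 5.1,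
  eqs. (5.1)–(5.3)) [AizenmanFernandezJSP1986] (held: `paper:url-b8cebc3f44bb`).
* H. Duminil-Copin, V. Tassion, CMP 343 (2016) 725, proof of Lemma 2.6 (Claims 1–2)
  [DuminilCopinTassionCMP2016] — the tree's source of the factorisation.
-/

noncomputable section

open Finset MeasureTheory
open scoped symmDiff ENNReal

namespace Literature.Probability.LatticeModels

variable {V : Type*} [DecidableEq V]

section Lexicon

variable {G : SimpleGraph V} [G.LocallyFinite] {Λ : Finset V}

local notation "Gg" => ghostGraph G Λ
local notation "Λg" => Finset.insertNone Λ
local notation "Eg" => edgesIn (ghostGraph G Λ) (Finset.insertNone Λ)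
local notation "Zg[" θ ", " X "]" =>
  gcurrentZ (ghostGraph G Λ) (Finset.insertNone Λ) θ (edgesIn (ghostGraph G Λ) (Finset.insertNone Λ)) X
local notation "ZIn[" θ ", " S ", " X "]" =>
  gcurrentZ (ghostGraph G Λ) (Finset.insertNone Λ) θ (edgesIn (ghostGraph G Λ) S) X
local notation "Conn[" m ", " u ", " v "]" =>
  CConn (ghostGraph G Λ) (Finset.insertNone Λ) m (edgesIn (ghostGraph G Λ) (Finset.insertNone Λ)) u v
local notation "∂g" => csources (ghostGraph G Λ) (Finset.insertNone Λ)
local notation "𝒮[" m ", " b "]" => clusterCompl (ghostGraph G Λ) (Finset.insertNone Λ) m b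

/-! ### Lemma 3.3 in stripped form -/

/-- **Aizenman–Fernández's Lemma 3.3, stripped form.** On the event `𝒮_b = S` (`S ⊆ Λ ∪ {g}`,
`b ∉ S`), for arbitrary source sets `X`, `Y`:
`(∑_{∂n₁ = X, ∂n₂ = Y} w w 𝟙[𝒮_b = S]) · Z_S(∅)² = Z_S(X ∩ S) Z_S(Y ∩ S) · ∑_{∂n₁ = X ∖ S, ∂n₂ = Y ∖ S} w w 𝟙[𝒮_b = S]`,
where `Z_S` sums currents on the edges inside `S` — "for each such cluster, summing independently
over the current configurations inside and outside the cluster" ((3.10)–(3.11); here `S` is the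
complement of the cluster, so "outside the cluster" is inside `S`). [cite: AizenmanFernandezJSP1986, §3.3, Lemmas 3.2–3.3, eqs. (3.10)–(3.11)] -/
theorem currentPairSum_clusterCompl_strip (θ : Sym2 (Option V) → ℝ) {S : Finset (Option V)} (hS : S ⊆ Λg)
    {b : Option V} (hb : b ∈ Λg \ S) (X Y : Finset (Option V)) :
    currentPairSum G Λ θ X Y (fun m => ind (𝒮[m, b] = S)) * (ZIn[θ, S, ∅] * ZIn[θ, S, ∅]) =
      ZIn[θ, S, X.filter (· ∈ S)] * ZIn[θ, S, Y.filter (· ∈ S)] *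
        currentPairSum G Λ θ (X.filter (· ∉ S)) (Y.filter (· ∉ S)) (fun m => ind (𝒮[m, b] = S)) := by
  rw [currentPairSum_clusterCompl_eq θ hS hb X Y,
    currentPairSum_clusterCompl_eq θ hS hb (X.filter (· ∉ S)) (Y.filter (· ∉ S))]
  have h1 : ∀ W : Finset (Option V), (W.filter (· ∉ S)).filter (· ∈ S) = ∅ := fun W =>
    filter_false_of_mem fun v hv => (mem_filter.1 hv).2
  have h2 : ∀ W : Finset (Option V), (W.filter (· ∉ S)).filter (· ∉ S) = W.filter (· ∉ S) := fun W =>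
    filter_true_of_mem fun v hv => (mem_filter.1 hv).2
  rw [h1, h1, h2, h2]
  ring

/-- On `{𝒮_b = S}` any functional of the pair which is a function of `𝒮_b` is constant: pair sums
against `𝟙[𝒮_b = S] · Ψ(𝒮_b)` are `Ψ(S)` times the pair sum against `𝟙[𝒮_b = S]`. [folklore] -/
theorem currentPairSum_ind_clusterCompl_mul (θ : Sym2 (Option V) → ℝ) (S : Finset (Option V)) (b : Option V)
    (X Y : Finset (Option V)) (Ψ : Finset (Option V) → ℝ≥0∞) :
    currentPairSum G Λ θ X Y (fun m => ind (𝒮[m, b] = S) * Ψ (𝒮[m, b])) =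
      Ψ S * currentPairSum G Λ θ X Y (fun m => ind (𝒮[m, b] = S)) := by
  rw [← currentPairSum_mul_left]
  refine currentPairSum_congr fun n₁ n₂ _ _ => ?_
  by_cases h : 𝒮[n₁ + n₂, b] = S
  · rw [ind_of_true h, h, one_mul, mul_one]
  · rw [ind_of_false h, zero_mul, mul_zero]

/-! ### The real-valued weights -/

variable (G Λ) in
/-- **The law of the cluster of `o`**: `clusterWeight θ o x S = Z⁻² ∑_{∂n₁ = ({o}∆{x})*, ∂n₂ = ∅} w(n₁)w(n₂) 𝟙[𝒮_o(n₁+n₂) = S]`,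
the weight of the event that the set of vertices of `Λ ∪ {g}` not connected to `o` by `n₁ + n₂`
is `S` (Aizenman–Fernández 1986, the weights `W(n₁)W(n₂)/Z² 𝟙[…]` of (3.12)–(3.16), resolved
according to the cluster of the source `o`). [cite: AizenmanFernandezJSP1986, §3.4, eqs. (3.12)–(3.16)] -/
def clusterWeight (θ : Sym2 (Option V) → ℝ) (o x : V) (S : Finset (Option V)) : ℝ :=
  (currentPairSum G Λ θ (starSet ({o} ∆ {x})) ∅ (fun m => ind (𝒮[m, some o] = S))).toReal /
    (Zg[θ, ∅]).toReal ^ 2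

variable (G Λ) in
/-- **The correlations of the system deprived of all bonds not inside `S`** (`S ⊆ Λ ∪ {g}`):
`corrIn θ S A = ⟨σ_A⟩_S`, the `θ`-state with every edge of the ghost graph not inside `S` switched
off (Aizenman–Fernández 1986, `⟨σ_B⟩_{C(p)^c}` of (3.10), with `S` the complement of the cluster;
if `g ∉ S` this is a zero-field system, and `⟨σ_A⟩_S = 0` unless `A* ⊆ S`). [cite: AizenmanFernandezJSP1986, §3.3, Lemma 3.2, eq. (3.10)] -/
def corrIn (θ : Sym2 (Option V) → ℝ) (S : Finset (Option V)) (A : Finset V) : ℝ :=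
  thetaCorr G Λ (cplOff θ (edgesIn (ghostGraph G Λ) (Finset.insertNone Λ) \ edgesIn (ghostGraph G Λ) S)) A

variable (G Λ) in
/-- **The law of `𝒮_g`** under the duplicated sourceless currents:
`hclusterWeight θ S' = Z⁻² ∑_{∂n₁ = ∂n₂ = ∅} w w 𝟙[𝒮_g = S']` (`S' ⊆ Λ` real vertices), the
measure `E` of Aizenman–Fernández 1986, (5.2), resolved according to the `h`-cluster
(`Z⁻² W(S')` with the tree's `dctW`). [cite: AizenmanFernandezJSP1986, §5.1, Lemma 5.1, eq. (5.2)] -/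
def hclusterWeight (θ : Sym2 (Option V) → ℝ) (S' : Finset V) : ℝ :=
  (dctW G Λ θ S').toReal / (Zg[θ, ∅]).toReal ^ 2

/-- `clusterWeight ≥ 0`. [folklore] -/
theorem clusterWeight_nonneg (θ : Sym2 (Option V) → ℝ) (o x : V) (S : Finset (Option V)) :
    0 ≤ clusterWeight G Λ θ o x S :=
  div_nonneg ENNReal.toReal_nonneg (pow_nonneg ENNReal.toReal_nonneg 2)

/-- `hclusterWeight ≥ 0`. [folklore] -/
theorem hclusterWeight_nonneg (θ : Sym2 (Option V) → ℝ) (S' : Finset V) : 0 ≤ hclusterWeight G Λ θ S' :=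
  div_nonneg ENNReal.toReal_nonneg (pow_nonneg ENNReal.toReal_nonneg 2)

/-- `corrIn` is a correlation of a `θ`-system with nonnegative couplings: `0 ≤ ⟨σ_A⟩_S` (`A ⊆ Λ`). [folklore] -/
theorem corrIn_nonneg {θ : Sym2 (Option V) → ℝ} (hθ : ∀ e, 0 ≤ θ e) (S : Finset (Option V)) {A : Finset V}
    (hA : A ⊆ Λ) : 0 ≤ corrIn G Λ θ S A :=
  thetaCorr_nonneg (cplOff_nonneg hθ _) hA

/-- `⟨σ_A⟩_S ≤ 1`. [folklore] -/
theorem corrIn_le_one (θ : Sym2 (Option V) → ℝ) (S : Finset (Option V)) (A : Finset V) :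
    corrIn G Λ θ S A ≤ 1 :=
  thetaCorr_le_one _ A

/-- **Griffiths II for the depleted systems**: `⟨σ_A⟩_S ≤ ⟨σ_A⟩_θ` (Aizenman–Fernández 1986, the
comparisons "`⟨σ⟩_{C^c} ≤ ⟨σ⟩`" of (5.7), (5.25), (5.35) (i)). [cite: AizenmanFernandezJSP1986, §5.2, proof of Thm. 5.6, the inequality after (5.25)] -/
theorem corrIn_le_thetaCorr {θ : Sym2 (Option V) → ℝ} (hθ : ∀ e, 0 ≤ θ e) (S : Finset (Option V)) {A : Finset V}
    (hA : A ⊆ Λ) : corrIn G Λ θ S A ≤ thetaCorr G Λ θ A :=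
  thetaCorr_cplOff_le hθ _ hA

/-- Monotonicity of the depleted systems in the retained region: `S ⊆ T` gives `⟨σ_A⟩_S ≤ ⟨σ_A⟩_T`. [cite: AizenmanFernandezJSP1986, §5.2, eq. (5.37)] -/
theorem corrIn_mono {θ : Sym2 (Option V) → ℝ} (hθ : ∀ e, 0 ≤ θ e) {S T : Finset (Option V)} (hST : S ⊆ T)
    {A : Finset V} (hA : A ⊆ Λ) : corrIn G Λ θ S A ≤ corrIn G Λ θ T A :=
  thetaCorr_cplOff_anti hθ (sdiff_subset_sdiff subset_rfl (edgesIn_mono Gg hST)) hA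

/-- `⟨σ_A⟩_S` as a ratio of current sums inside `S` (`S ⊆ Λ ∪ {g}`, `A ⊆ Λ`). [cite: AizenmanFernandezJSP1986, §3.3, Lemma 3.2, eq. (3.10)] -/
theorem corrIn_eq_gcurrentZ_div {θ : Sym2 (Option V) → ℝ} (hθ : ∀ e, 0 ≤ θ e) {S : Finset (Option V)}
    (hS : S ⊆ Λg) {A : Finset V} (hA : A ⊆ Λ) :
    corrIn G Λ θ S A = (ZIn[θ, S, starSet A]).toReal / (ZIn[θ, S, ∅]).toReal :=
  thetaCorr_cplOff_eq_gcurrentZ_div hθ hS hA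

/-- The depleted normalising sum is positive and finite. [folklore] -/
theorem toReal_gcurrentZ_in_pos {θ : Sym2 (Option V) → ℝ} (hθ : ∀ e, 0 ≤ θ e) {S : Finset (Option V)}
    (hS : S ⊆ Λg) : 0 < (ZIn[θ, S, ∅]).toReal :=
  ENNReal.toReal_pos (ne_of_gt (lt_of_lt_of_le zero_lt_one (one_le_gcurrentZ_empty θ _)))
    (gcurrentZ_ne_top hθ (edgesIn_mono Gg hS) ∅)

/-- Depleted current sums are finite. [folklore] -/
theorem gcurrentZ_in_ne_top {θ : Sym2 (Option V) → ℝ} (hθ : ∀ e, 0 ≤ θ e) {S : Finset (Option V)}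
    (hS : S ⊆ Λg) (X : Finset (Option V)) : ZIn[θ, S, X] ≠ ∞ :=
  gcurrentZ_ne_top hθ (edgesIn_mono Gg hS) X

/-! ### Correlation (3.15): the truncated pair function resolved over the cluster of `o` -/

/-- Pair sums against `𝟙[𝒮_o ∈ 𝒯]` are sums of the cluster weights over `𝒯`. [folklore] -/
theorem currentPairSum_ind_mem_eq_sum (θ : Sym2 (Option V) → ℝ) (X Y : Finset (Option V)) (b : Option V)
    (𝒯 : Finset (Finset (Option V))) :
    currentPairSum G Λ θ X Y (fun m => ind (𝒮[m, b] ∈ 𝒯)) =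
      ∑ S ∈ 𝒯, currentPairSum G Λ θ X Y (fun m => ind (𝒮[m, b] = S)) := by
  rw [← currentPairSum_finset_sum]
  exact currentPairSum_congr fun n₁ n₂ _ _ => (sum_ind_eq_eq_ind_mem 𝒯 _).symm

/-- **Correlation (3.15) of Aizenman–Fernández**: for `o, x ∈ Λ` and `θ ≥ 0`,
`⟨σ_oσ_x⟩_θ - ⟨σ_o⟩_θ⟨σ_x⟩_θ = ∑_{S ⊆ Λ ∪ {g}, g ∈ S} clusterWeight θ o x S`
("`⟨σ_x;σ_y⟩ = ∑_{∂n₁ = {x}∆{y}, ∂n₂ = ∅} W(n₁)W(n₂)/Z² 𝟙[n₁ + n₂ : x ↮ h]`", the event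
`x ↮ h` being `g ∈ 𝒮_x`). [cite: AizenmanFernandezJSP1986, §3.4, Cor. 3.5, eq. (3.15)] -/
theorem thetaCorr_pair_sub_eq_sum_clusterWeight {θ : Sym2 (Option V) → ℝ} (hθ : ∀ e, 0 ≤ θ e) {o x : V}
    (ho : o ∈ Λ) (hx : x ∈ Λ) :
    thetaCorr G Λ θ ({o} ∆ {x}) - thetaCorr G Λ θ {o} * thetaCorr G Λ θ {x} =
      ∑ S ∈ (Λg).powerset.filter (fun S => (none : Option V) ∈ S), clusterWeight G Λ θ o x S := by
  -- the representation `Z⁻² ∑ w w 𝟙[o ↮ g]` of `MeanFieldDifferentialInequality`, for general `θ`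
  have hox : ({o} ∆ {x} : Finset V) ⊆ Λ :=
    symmDiff_le_sup.trans (sup_le (singleton_subset_iff.2 ho) (singleton_subset_iff.2 hx))
  have hZpos : 0 < (Zg[θ, ∅]).toReal := toReal_gcurrentZ_ghost_empty_pos subset_rfl hθ subset_rfl
  have hrepr : thetaCorr G Λ θ ({o} ∆ {x}) - thetaCorr G Λ θ {o} * thetaCorr G Λ θ {x} =
      (currentPairSum G Λ θ (starSet ({o} ∆ {x})) ∅ (fun m => ind (¬Conn[m, some o, none]))).toReal /
        (Zg[θ, ∅]).toReal ^ 2 := by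
    rw [thetaCorr_eq_gcurrentZ_div hθ hox, thetaCorr_eq_gcurrentZ_div hθ (singleton_subset_iff.2 ho),
      thetaCorr_eq_gcurrentZ_div hθ (singleton_subset_iff.2 hx)]
    have h1 := congrArg ENNReal.toReal (gcurrentZ_pair_mul_empty (G := G) (Λ := Λ) θ o x)
    have h2 := congrArg ENNReal.toReal (gcurrentZ_single_mul_single (G := G) (Λ := Λ) hθ o x)
    rw [ENNReal.toReal_mul, ENNReal.toReal_add (currentPairSum_ne_top hθ _ _ fun _ => ind_le_one _)
      (currentPairSum_ne_top hθ _ _ fun _ => ind_le_one _)] at h1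
    rw [ENNReal.toReal_mul] at h2
    field_simp
    linear_combination h1 - h2
  rw [hrepr]
  -- resolve `𝟙[o ↮ g]` over the values of `𝒮_o`
  have hev : currentPairSum G Λ θ (starSet ({o} ∆ {x})) ∅ (fun m => ind (¬Conn[m, some o, none])) =
      currentPairSum G Λ θ (starSet ({o} ∆ {x})) ∅
        (fun m => ind (𝒮[m, some o] ∈ (Λg).powerset.filter (fun S => (none : Option V) ∈ S))) := by
    refine currentPairSum_congr fun n₁ n₂ _ _ => ind_congr ?_
    rw [mem_filter, mem_powerset, none_mem_clusterCompl_iff]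
    exact ⟨fun h => ⟨clusterCompl_subset _ _, h⟩, fun h => h.2⟩
  rw [hev, currentPairSum_ind_mem_eq_sum,
    ENNReal.toReal_sum (fun S _ => currentPairSum_ne_top hθ _ _ fun _ => ind_le_one _), sum_div]
  rfl

/-- **The total mass of the cluster weights**: `∑_{S ⊆ Λ ∪ {g}} clusterWeight θ o x S = ⟨σ_oσ_x⟩_θ`
(`Z(({o}∆{x})*) Z(∅) = ∑_{({o}∆{x})*, ∅} w w`). [cite: AizenmanFernandezJSP1986, §3.2, eq. (3.6)] -/
theorem sum_clusterWeight_eq {θ : Sym2 (Option V) → ℝ} (hθ : ∀ e, 0 ≤ θ e) {o x : V} (ho : o ∈ Λ) (hx : x ∈ Λ) :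
    ∑ S ∈ (Λg).powerset, clusterWeight G Λ θ o x S = thetaCorr G Λ θ ({o} ∆ {x}) := by
  have hox : ({o} ∆ {x} : Finset V) ⊆ Λ :=
    symmDiff_le_sup.trans (sup_le (singleton_subset_iff.2 ho) (singleton_subset_iff.2 hx))
  have hZpos : 0 < (Zg[θ, ∅]).toReal := toReal_gcurrentZ_ghost_empty_pos subset_rfl hθ subset_rfl
  have hall : currentPairSum G Λ θ (starSet ({o} ∆ {x})) ∅ (fun _ => 1) =
      currentPairSum G Λ θ (starSet ({o} ∆ {x})) ∅ (fun m => ind (𝒮[m, some o] ∈ (Λg).powerset)) :=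
    currentPairSum_congr fun n₁ n₂ _ _ => (ind_of_true (mem_powerset.2 (clusterCompl_subset _ _))).symm
  unfold clusterWeight
  rw [← sum_div, ← ENNReal.toReal_sum (fun S _ => currentPairSum_ne_top hθ _ _ fun _ => ind_le_one _),
    ← currentPairSum_ind_mem_eq_sum, ← hall, currentPairSum_one, ENNReal.toReal_mul,
    thetaCorr_eq_gcurrentZ_div hθ hox]
  field_simp

/-- The cluster weights vanish unless `o, x ∉ S` (the sources are joined to `o`). [folklore] -/
theorem clusterWeight_eq_zero_of_mem {θ : Sym2 (Option V) → ℝ} {o x : V} {S : Finset (Option V)}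
    (h : (some o : Option V) ∈ S ∨ (some x : Option V) ∈ S) : clusterWeight G Λ θ o x S = 0 := by
  unfold clusterWeight
  have h0 : currentPairSum G Λ θ (starSet ({o} ∆ {x})) ∅ (fun m => ind (𝒮[m, some o] = S)) = 0 := by
    have hz : currentPairSum G Λ θ (starSet ({o} ∆ {x})) ∅ (fun _ => 0) = 0 := by
      unfold currentPairSum; simp
    rw [← hz]
    refine currentPairSum_congr fun n₁ n₂ h1 _ => ind_of_false fun hS => ?_
    rcases h with hoS | hxS
    · rw [← hS] at hoS
      exact not_mem_clusterCompl_self _ _ hoS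
    · rw [← hS] at hxS
      have hconn : Conn[n₁ + n₂, some o, some x] := by
        by_cases hox : o = x
        · subst hox; exact Relation.ReflTransGen.refl
        · have hsrc : ∂g n₁ = ({some o} ∆ {some x} : Finset (Option V)) := by rw [h1, starSet_pair]
          exact (cconn_of_csources_eq (fun h => hox (Option.some_injective _ h)) hsrc).mono
            fun e => Nat.le_add_right _ _
      exact (mem_clusterCompl.1 hxS).2 hconn
  rw [h0, ENNReal.toReal_zero, zero_div]

/-! ### Correlation (3.13)/(3.16): the truncated three-point function -/

/-- **The depleted magnetisation comes out of the cluster sum (Tool A for (3.13))**: under the side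
conditions `g, y ∈ S`, `o, x ∉ S` (`S ⊆ Λ ∪ {g}`),
`Z⁻² ∑_{∂n₁ = (oxy)*, ∂n₂ = ∅} w w 𝟙[𝒮_o = S] = ⟨σ_y⟩_S · clusterWeight θ o x S`
(Aizenman–Fernández 1986, (3.12) = (3.13): `S_x(A,B) = ∑ W W/Z² 𝟙[…] ⟨σ_B⟩_{C^c}`, with
`A = {x}`, `B = {y}`). [cite: AizenmanFernandezJSP1986, §3.4, eqs. (3.12)–(3.13)] -/
theorem currentPairSum_triple_clusterCompl_toReal {θ : Sym2 (Option V) → ℝ} (hθ : ∀ e, 0 ≤ θ e) {o x y : V}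
    (ho : o ∈ Λ) (hy : y ∈ Λ) (hxy : x ≠ y) {S : Finset (Option V)} (hSΛ : S ⊆ Λg) (hS : Claim1Side o x y S) :
    (currentPairSum G Λ θ (Finset.insertNone ({o} ∆ ({x} ∆ {y}))) ∅ (fun m => ind (𝒮[m, some o] = S))).toReal /
        (Zg[θ, ∅]).toReal ^ 2 =
      corrIn G Λ θ S {y} * clusterWeight G Λ θ o x S := by
  have hb : (some o : Option V) ∈ Λg \ S := mem_sdiff.2 ⟨Finset.some_mem_insertNone.2 ho, hS.2.2.1⟩
  have hstrip := currentPairSum_clusterCompl_strip (G := G) (Λ := Λ) θ hSΛ hb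
    (Finset.insertNone ({o} ∆ ({x} ∆ {y}))) ∅
  rw [filter_mem_insertNone_triple hxy hS, filter_not_mem_insertNone_triple hxy hS] at hstrip
  simp only [filter_empty] at hstrip
  have hpos := toReal_gcurrentZ_in_pos (G := G) (Λ := Λ) hθ hSΛ
  have hfin := gcurrentZ_in_ne_top (G := G) (Λ := Λ) hθ hSΛ
  have h1 := congrArg ENNReal.toReal hstrip
  rw [ENNReal.toReal_mul, ENNReal.toReal_mul, ENNReal.toReal_mul, ENNReal.toReal_mul] at h1
  rw [corrIn_eq_gcurrentZ_div hθ hSΛ (singleton_subset_iff.2 hy), clusterWeight]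
  have hZpos : 0 < (Zg[θ, ∅]).toReal := toReal_gcurrentZ_ghost_empty_pos subset_rfl hθ subset_rfl
  field_simp
  nlinarith [h1, hpos]

/-- **`δ` resolved over the cluster of `o` ((3.13) for `S_o({x},{y})`)**: for `o, x, y ∈ Λ`, `x ≠ y`,
`Z⁻² δ_{x,y} = ∑_{S ⊆ Λ ∪ {g}: g, y ∈ S; o, x ∉ S} ⟨σ_y⟩_S · clusterWeight θ o x S`
(`δ_{x,y} = ∑_{(oxy)*, ∅} w w 𝟙[o ↮ g, o ↮ y, o ⟷ x]` is the tree's `dctDelta`; this is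
Aizenman–Fernández's `S_o({x},{y})` written "in terms of the less ferromagnetic system",
(3.12)–(3.13)). [cite: AizenmanFernandezJSP1986, §3.4, eqs. (3.12)–(3.13)] -/
theorem dctDelta_toReal_eq_sum {θ : Sym2 (Option V) → ℝ} (hθ : ∀ e, 0 ≤ θ e) {o x y : V}
    (ho : o ∈ Λ) (hx : x ∈ Λ) (hy : y ∈ Λ) (hxy : x ≠ y) :
    (dctDelta G Λ θ o x y).toReal / (Zg[θ, ∅]).toReal ^ 2 =
      ∑ S ∈ (Λg).powerset.filter (Claim1Side o x y), corrIn G Λ θ S {y} * clusterWeight G Λ θ o x S := by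
  rw [dctDelta_eq_sum θ hx hy, ENNReal.toReal_sum (fun S _ => currentPairSum_ne_top hθ _ _ fun _ => ind_le_one _),
    sum_div]
  refine sum_congr rfl fun S hS => ?_
  rw [mem_filter, mem_powerset] at hS
  exact currentPairSum_triple_clusterCompl_toReal hθ ho hy hxy hS.1 hS.2

/-- **The truncated three-point function of the `θ`-system as a double current** ((2.11) of
Duminil-Copin–Tassion for general `θ ≥ 0`; Aizenman–Fernández's Prop. 3.4 for `A = {x, y}`):
`⟨σ_oσ_xσ_y⟩_θ - ⟨σ_o⟩_θ⟨σ_xσ_y⟩_θ = Z⁻² ∑_{∂n₁ = (oxy)*, ∂n₂ = ∅} w w 𝟙[o ↮ g]`. [cite: AizenmanFernandezJSP1986, §3.4, Prop. 3.4, eq. (3.14)] -/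
theorem thetaCorr_triple_sub_eq {θ : Sym2 (Option V) → ℝ} (hθ : ∀ e, 0 ≤ θ e) {o x y : V} (ho : o ∈ Λ)
    (hx : x ∈ Λ) (hy : y ∈ Λ) :
    thetaCorr G Λ θ ({o} ∆ ({x} ∆ {y})) - thetaCorr G Λ θ {o} * thetaCorr G Λ θ ({x} ∆ {y}) =
      (currentPairSum G Λ θ (Finset.insertNone ({o} ∆ ({x} ∆ {y}))) ∅
          (fun m => ind (¬Conn[m, some o, none]))).toReal / (Zg[θ, ∅]).toReal ^ 2 := by
  have hxy : ({x} ∆ {y} : Finset V) ⊆ Λ :=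
    symmDiff_le_sup.trans (sup_le (singleton_subset_iff.2 hx) (singleton_subset_iff.2 hy))
  have hoxy : ({o} ∆ ({x} ∆ {y}) : Finset V) ⊆ Λ :=
    symmDiff_le_sup.trans (sup_le (singleton_subset_iff.2 ho) hxy)
  have hstar : starSet ({o} ∆ ({x} ∆ {y})) = Finset.insertNone ({o} ∆ ({x} ∆ {y})) := by
    have heven : Even #(Finset.insertNone ({o} ∆ ({x} ∆ {y}))) := by
      rw [insertNone_triple', even_card_symmDiff_iff]
      exact iff_of_true (even_card_singleton_symmDiff _ _) (even_card_singleton_symmDiff _ _)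
    rw [← (eraseNone_eq_iff_eq_starSet heven _).1 (Finset.eraseNone_insertNone _)]
  rw [thetaCorr_eq_gcurrentZ_div hθ hoxy, thetaCorr_eq_gcurrentZ_div hθ (singleton_subset_iff.2 ho),
    thetaCorr_eq_gcurrentZ_div hθ hxy, hstar]
  have hZpos : 0 < (Zg[θ, ∅]).toReal := toReal_gcurrentZ_ghost_empty_pos subset_rfl hθ subset_rfl
  have hfin : ∀ X, Zg[θ, X] ≠ ∞ := fun X => gcurrentZ_ne_top hθ subset_rfl X
  have h1 := congrArg ENNReal.toReal (gcurrentZ_triple_mul_empty (G := G) (Λ := Λ) θ o x y)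
  have h2 := congrArg ENNReal.toReal (gcurrentZ_pair_mul_single (G := G) (Λ := Λ) hθ o x y)
  have hP1 : currentPairSum G Λ θ (Finset.insertNone ({o} ∆ ({x} ∆ {y}))) ∅ (fun m => ind Conn[m, some o, none]) ≠ ∞ :=
    currentPairSum_ne_top hθ _ _ fun _ => ind_le_one _
  have hP2 : currentPairSum G Λ θ (Finset.insertNone ({o} ∆ ({x} ∆ {y}))) ∅
      (fun m => ind (¬Conn[m, some o, none])) ≠ ∞ :=
    currentPairSum_ne_top hθ _ _ fun _ => ind_le_one _
  rw [ENNReal.toReal_mul, ENNReal.toReal_add hP1 hP2] at h1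
  rw [ENNReal.toReal_mul] at h2
  field_simp
  linear_combination h1 - h2

/-- **Correlation (3.16) of Aizenman–Fernández**: for `o, x, y ∈ Λ` with `x ≠ y` and `θ ≥ 0`,
`⟨σ_oσ_xσ_y⟩ - ⟨σ_o⟩⟨σ_xσ_y⟩ = ∑_{S: g,y ∈ S; o,x ∉ S} ⟨σ_y⟩_S clusterWeight o x S + ∑_{S: g,x ∈ S; o,y ∉ S} ⟨σ_x⟩_S clusterWeight o y S`
("`⟨σ_x, σ_yσ_z⟩ = ∑_{∂n₁ = {x}∆{y}, ∂n₂ = ∅} W W/Z² 𝟙[x ↮ h] ⟨σ_z⟩_{C_{n₁+n₂}(x)^c} + {y ⇔ z permutation}`"). [cite: AizenmanFernandezJSP1986, §3.4, Cor. 3.5, eq. (3.16)] -/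
theorem thetaCorr_triple_sub_eq_sum {θ : Sym2 (Option V) → ℝ} (hθ : ∀ e, 0 ≤ θ e) {o x y : V} (ho : o ∈ Λ)
    (hx : x ∈ Λ) (hy : y ∈ Λ) (hxy : x ≠ y) :
    thetaCorr G Λ θ ({o} ∆ ({x} ∆ {y})) - thetaCorr G Λ θ {o} * thetaCorr G Λ θ ({x} ∆ {y}) =
      ∑ S ∈ (Λg).powerset.filter (Claim1Side o x y), corrIn G Λ θ S {y} * clusterWeight G Λ θ o x S +
        ∑ S ∈ (Λg).powerset.filter (Claim1Side o y x), corrIn G Λ θ S {x} * clusterWeight G Λ θ o y S := by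
  rw [thetaCorr_triple_sub_eq hθ ho hx hy, currentPairSum_notConn_eq_dctDelta_add θ hxy,
    ENNReal.toReal_add (dctDelta_ne_top hθ o x y) (dctDelta_ne_top hθ o y x), add_div,
    dctDelta_toReal_eq_sum hθ ho hx hy hxy, dctDelta_toReal_eq_sum hθ ho hy hx (Ne.symm hxy)]

/-! ### Lemma 5.1: conditioning on the `h`-cluster -/

/-- If the sources `{a} ∆ {b}` of one of the currents straddle `S'` (`a ∈ S'`, `b ∉ S'`), the event
`𝒮_g = S'` is impossible (the sources are joined). [folklore] -/
theorem currentPairSum_clusterCompl_none_eq_zero_left (θ : Sym2 (Option V) → ℝ) {S' : Finset V} {a b : V}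
    (ha : a ∈ S') (hbS : b ∉ S') (hbΛ : b ∈ Λ) (Y : Finset (Option V)) :
    currentPairSum G Λ θ (starSet ({a} ∆ {b})) Y
        (fun m => ind (𝒮[m, none] = S'.map Function.Embedding.some)) = 0 := by
  have h0 : currentPairSum G Λ θ (starSet ({a} ∆ {b})) Y (fun _ => 0) = 0 := by
    unfold currentPairSum; simp
  rw [← h0]
  refine currentPairSum_congr fun n₁ n₂ h1 _ => ind_of_false fun hS => ?_
  have hab : a ≠ b := fun h => hbS (h ▸ ha)
  have hsrc : ∂g n₁ = ({some a} ∆ {some b} : Finset (Option V)) := by rw [h1, starSet_pair]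
  have hconn : Conn[n₁ + n₂, some a, some b] :=
    (cconn_of_csources_eq (fun h => hab (Option.some_injective _ h)) hsrc).mono fun e => Nat.le_add_right _ _
  have haS : (some a : Option V) ∈ 𝒮[n₁ + n₂, none] := hS ▸ mem_map_of_mem _ ha
  have hbS' : (some b : Option V) ∉ 𝒮[n₁ + n₂, none] := fun h => by
    rw [hS] at h
    obtain ⟨t, ht, htx⟩ := mem_map.1 h
    exact hbS ((Option.some_injective _ htx) ▸ ht)
  rw [some_mem_clusterCompl_iff hbΛ, not_not] at hbS'
  exact (mem_clusterCompl.1 haS).2 (hbS'.trans hconn.symm)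

/-- The same for the second current. [folklore] -/
theorem currentPairSum_clusterCompl_none_eq_zero_right (θ : Sym2 (Option V) → ℝ) {S' : Finset V} {a b : V}
    (ha : a ∈ S') (hbS : b ∉ S') (hbΛ : b ∈ Λ) (X : Finset (Option V)) :
    currentPairSum G Λ θ X (starSet ({a} ∆ {b}))
        (fun m => ind (𝒮[m, none] = S'.map Function.Embedding.some)) = 0 := by
  have h0 : currentPairSum G Λ θ X (starSet ({a} ∆ {b})) (fun _ => 0) = 0 := by
    unfold currentPairSum; simp
  rw [← h0]
  refine currentPairSum_congr fun n₁ n₂ _ h2 => ind_of_false fun hS => ?_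
  have hab : a ≠ b := fun h => hbS (h ▸ ha)
  have hsrc : ∂g n₂ = ({some a} ∆ {some b} : Finset (Option V)) := by rw [h2, starSet_pair]
  have hconn : Conn[n₁ + n₂, some a, some b] :=
    (cconn_of_csources_eq (fun h => hab (Option.some_injective _ h)) hsrc).mono fun e => Nat.le_add_left _ _
  have haS : (some a : Option V) ∈ 𝒮[n₁ + n₂, none] := hS ▸ mem_map_of_mem _ ha
  have hbS' : (some b : Option V) ∉ 𝒮[n₁ + n₂, none] := fun h => by
    rw [hS] at h
    obtain ⟨t, ht, htx⟩ := mem_map.1 h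
    exact hbS ((Option.some_injective _ htx) ▸ ht)
  rw [some_mem_clusterCompl_iff hbΛ, not_not] at hbS'
  exact (mem_clusterCompl.1 haS).2 (hbS'.trans hconn.symm)

/-- The lift of a set of real vertices lies in `Λ ∪ {g}` and misses the ghost. [folklore] -/
theorem map_some_subset_and_none {S' : Finset V} (hS' : S' ⊆ Λ) :
    S'.map Function.Embedding.some ⊆ Λg ∧ (none : Option V) ∈ Λg \ S'.map Function.Embedding.some := by
  refine ⟨fun v hv => ?_, mem_sdiff.2 ⟨Finset.mem_insertNone.2 (by simp), fun h => ?_⟩⟩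
  · obtain ⟨t, ht, rfl⟩ := mem_map.1 hv
    exact Finset.some_mem_insertNone.2 (hS' ht)
  · obtain ⟨t, -, ht⟩ := mem_map.1 h
    exact Option.some_ne_none t ht

/-- A lifted pair source set lies inside the lift of `S'` when its points do. [folklore] -/
theorem starSet_pair_subset_map {S' : Finset V} {a b : V} (ha : a ∈ S') (hb : b ∈ S') :
    ∀ v ∈ starSet ({a} ∆ {b}), v ∈ S'.map Function.Embedding.some := by
  intro v hv
  rw [starSet_pair, mem_symmDiff, mem_singleton, mem_singleton] at hv
  rcases hv with ⟨rfl, -⟩ | ⟨rfl, -⟩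
  · exact mem_map_of_mem _ ha
  · exact mem_map_of_mem _ hb

/-- **Lemma 5.1 of Aizenman–Fernández for a fixed `h`-cluster** (Tool A at `b = g`): for
`S' ⊆ Λ` containing `o, x, u, v`,
`Z⁻² ∑_{∂n₁ = ({o}∆{x})*, ∂n₂ = ({u}∆{v})*} w w 𝟙[𝒮_g = S'] = ⟨σ_oσ_x⟩_{S',0} ⟨σ_uσ_v⟩_{S',0} · hclusterWeight S'`
(the depleted systems at `𝒮_g` carry no field). [cite: AizenmanFernandezJSP1986, §5.1, Lemma 5.1, eq. (5.1)] -/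
theorem currentPairSum_pair_pair_hcluster_toReal {θ : Sym2 (Option V) → ℝ} (hθ : ∀ e, 0 ≤ θ e) {S' : Finset V}
    (hS' : S' ⊆ Λ) {o x u v : V} (ho : o ∈ S') (hx : x ∈ S') (hu : u ∈ S') (hv : v ∈ S') :
    (currentPairSum G Λ θ (starSet ({o} ∆ {x})) (starSet ({u} ∆ {v}))
          (fun m => ind (𝒮[m, none] = S'.map Function.Embedding.some))).toReal / (Zg[θ, ∅]).toReal ^ 2 =
      corrIn G Λ θ (S'.map Function.Embedding.some) ({o} ∆ {x}) *
        corrIn G Λ θ (S'.map Function.Embedding.some) ({u} ∆ {v}) * hclusterWeight G Λ θ S' := by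
  obtain ⟨hSΛ, hb⟩ := map_some_subset_and_none (Λ := Λ) hS'
  set S := S'.map Function.Embedding.some with hSdef
  have hstrip := currentPairSum_clusterCompl_strip (G := G) (Λ := Λ) θ hSΛ hb (starSet ({o} ∆ {x})) (starSet ({u} ∆ {v}))
  rw [filter_true_of_mem (starSet_pair_subset_map ho hx), filter_true_of_mem (starSet_pair_subset_map hu hv),
    filter_false_of_mem (fun w hw => not_not.2 (starSet_pair_subset_map ho hx w hw)),
    filter_false_of_mem (fun w hw => not_not.2 (starSet_pair_subset_map hu hv w hw))] at hstrip
  have hpos := toReal_gcurrentZ_in_pos (G := G) (Λ := Λ) hθ hSΛ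
  have h1 := congrArg ENNReal.toReal hstrip
  rw [ENNReal.toReal_mul, ENNReal.toReal_mul, ENNReal.toReal_mul, ENNReal.toReal_mul] at h1
  have hox : ({o} ∆ {x} : Finset V) ⊆ Λ :=
    symmDiff_le_sup.trans (sup_le (singleton_subset_iff.2 (hS' ho)) (singleton_subset_iff.2 (hS' hx)))
  have huv : ({u} ∆ {v} : Finset V) ⊆ Λ :=
    symmDiff_le_sup.trans (sup_le (singleton_subset_iff.2 (hS' hu)) (singleton_subset_iff.2 (hS' hv)))
  rw [corrIn_eq_gcurrentZ_div hθ hSΛ hox, corrIn_eq_gcurrentZ_div hθ hSΛ huv, hclusterWeight, dctW]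
  have hZpos : 0 < (Zg[θ, ∅]).toReal := toReal_gcurrentZ_ghost_empty_pos subset_rfl hθ subset_rfl
  field_simp
  nlinarith [h1, hpos]

/-- **Lemma 5.1 of Aizenman–Fernández, eq. (5.1), for two pairs**: for `o, x, u, v ∈ Λ`,
`Z⁻² ∑_{∂n₁ = ({o}∆{x})*, ∂n₂ = ({u}∆{v})*} w w 𝟙[o ↮ g, u ↮ g] = ∑_{S' ⊆ Λ: o,x,u,v ∈ S'} hclusterWeight S' ⟨σ_oσ_x⟩_{S',0}⟨σ_uσ_v⟩_{S',0}`
("`∑_{∂n₁ = A, ∂n₂ = B} W W/Z² 𝟙[p ↮ A ∪ B] = E{⟨σ_A⟩_{C(p)^c} ⟨σ_B⟩_{C(p)^c}}`" with `p = h`). [cite: AizenmanFernandezJSP1986, §5.1, Lemma 5.1, eq. (5.1)] -/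
theorem pairSum_hcluster_eq_sum {θ : Sym2 (Option V) → ℝ} (hθ : ∀ e, 0 ≤ θ e) {o x u v : V} (ho : o ∈ Λ)
    (hx : x ∈ Λ) (hu : u ∈ Λ) (hv : v ∈ Λ) :
    (currentPairSum G Λ θ (starSet ({o} ∆ {x})) (starSet ({u} ∆ {v}))
          (fun m => ind (¬Conn[m, some o, none] ∧ ¬Conn[m, some u, none]))).toReal / (Zg[θ, ∅]).toReal ^ 2 =
      ∑ S' ∈ Λ.powerset.filter (fun S' => o ∈ S' ∧ x ∈ S' ∧ u ∈ S' ∧ v ∈ S'),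
        hclusterWeight G Λ θ S' * (corrIn G Λ θ (S'.map Function.Embedding.some) ({o} ∆ {x}) *
          corrIn G Λ θ (S'.map Function.Embedding.some) ({u} ∆ {v})) := by
  -- decompose over `𝒮_g`
  have hdec : currentPairSum G Λ θ (starSet ({o} ∆ {x})) (starSet ({u} ∆ {v}))
        (fun m => ind (¬Conn[m, some o, none] ∧ ¬Conn[m, some u, none])) =
      ∑ S' ∈ Λ.powerset.filter (fun S' => o ∈ S' ∧ u ∈ S'),
        currentPairSum G Λ θ (starSet ({o} ∆ {x})) (starSet ({u} ∆ {v}))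
          (fun m => ind (𝒮[m, none] = S'.map Function.Embedding.some)) := by
    rw [← currentPairSum_finset_sum]
    refine currentPairSum_congr fun n₁ n₂ _ _ => ?_
    rw [sum_ind_clusterCompl_none, mem_eraseNone_clusterCompl_none_iff ho, mem_eraseNone_clusterCompl_none_iff hu]
  rw [hdec, ENNReal.toReal_sum (fun S' _ => currentPairSum_ne_top hθ _ _ fun _ => ind_le_one _), sum_div]
  -- the terms with `x ∉ S'` or `v ∉ S'` vanish
  rw [← sum_filter_add_sum_filter_not (Λ.powerset.filter (fun S' => o ∈ S' ∧ u ∈ S')) (fun S' => x ∈ S' ∧ v ∈ S')]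
  have hzero : ∑ S' ∈ (Λ.powerset.filter (fun S' => o ∈ S' ∧ u ∈ S')).filter (fun S' => ¬(x ∈ S' ∧ v ∈ S')),
      (currentPairSum G Λ θ (starSet ({o} ∆ {x})) (starSet ({u} ∆ {v}))
        (fun m => ind (𝒮[m, none] = S'.map Function.Embedding.some))).toReal / (Zg[θ, ∅]).toReal ^ 2 = 0 := by
    refine sum_eq_zero fun S' hS' => ?_
    rw [mem_filter, mem_filter] at hS'
    rcases not_and_or.1 hS'.2 with hxS | hvS
    · rw [currentPairSum_clusterCompl_none_eq_zero_left θ hS'.1.2.1 hxS hx, ENNReal.toReal_zero, zero_div]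
    · rw [currentPairSum_clusterCompl_none_eq_zero_right θ hS'.1.2.2 hvS hv, ENNReal.toReal_zero, zero_div]
  rw [hzero, add_zero, filter_filter]
  have hset : (Λ.powerset.filter fun S' => (o ∈ S' ∧ u ∈ S') ∧ x ∈ S' ∧ v ∈ S') =
      Λ.powerset.filter (fun S' => o ∈ S' ∧ x ∈ S' ∧ u ∈ S' ∧ v ∈ S') :=
    filter_congr fun S' _ => by tauto
  rw [hset]
  refine sum_congr rfl fun S' hS' => ?_
  rw [mem_filter, mem_powerset] at hS'
  rw [currentPairSum_pair_pair_hcluster_toReal hθ hS'.1 hS'.2.1 hS'.2.2.1 hS'.2.2.2.1 hS'.2.2.2.2]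
  ring

/-- **Eq. (5.3) of Aizenman–Fernández**: `∑_{S' ∋ o, x} hclusterWeight S' ⟨σ_oσ_x⟩_{S',0} = ⟨σ_oσ_x⟩ - ⟨σ_o⟩⟨σ_x⟩`
("`⟨σ_x;σ_y⟩ = E{⟨σ_xσ_y⟩_{C(h)^c}}`"), for `o, x ∈ Λ`. [cite: AizenmanFernandezJSP1986, §5.1, Lemma 5.1, eq. (5.3)] -/
theorem sum_hclusterWeight_mul_corrIn_pair {θ : Sym2 (Option V) → ℝ} (hθ : ∀ e, 0 ≤ θ e) {o x : V} (ho : o ∈ Λ)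
    (hx : x ∈ Λ) :
    ∑ S' ∈ Λ.powerset.filter (fun S' => o ∈ S' ∧ x ∈ S'),
        hclusterWeight G Λ θ S' * corrIn G Λ θ (S'.map Function.Embedding.some) ({o} ∆ {x}) =
      thetaCorr G Λ θ ({o} ∆ {x}) - thetaCorr G Λ θ {o} * thetaCorr G Λ θ {x} := by
  have h := pairSum_hcluster_eq_sum (G := G) (Λ := Λ) hθ ho hx ho ho (u := o) (v := o)
  have hoo : ({o} ∆ {o} : Finset V) = ∅ := symmDiff_self _
  rw [hoo, starSet_empty] at h
  -- the left side of `h` is the truncated pair representation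
  have hrepr : thetaCorr G Λ θ ({o} ∆ {x}) - thetaCorr G Λ θ {o} * thetaCorr G Λ θ {x} =
      (currentPairSum G Λ θ (starSet ({o} ∆ {x})) ∅ (fun m => ind (¬Conn[m, some o, none]))).toReal /
        (Zg[θ, ∅]).toReal ^ 2 := by
    have hox : ({o} ∆ {x} : Finset V) ⊆ Λ :=
      symmDiff_le_sup.trans (sup_le (singleton_subset_iff.2 ho) (singleton_subset_iff.2 hx))
    have hZpos : 0 < (Zg[θ, ∅]).toReal := toReal_gcurrentZ_ghost_empty_pos subset_rfl hθ subset_rfl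
    rw [thetaCorr_eq_gcurrentZ_div hθ hox, thetaCorr_eq_gcurrentZ_div hθ (singleton_subset_iff.2 ho),
      thetaCorr_eq_gcurrentZ_div hθ (singleton_subset_iff.2 hx)]
    have h1 := congrArg ENNReal.toReal (gcurrentZ_pair_mul_empty (G := G) (Λ := Λ) θ o x)
    have h2 := congrArg ENNReal.toReal (gcurrentZ_single_mul_single (G := G) (Λ := Λ) hθ o x)
    rw [ENNReal.toReal_mul, ENNReal.toReal_add (currentPairSum_ne_top hθ _ _ fun _ => ind_le_one _)
      (currentPairSum_ne_top hθ _ _ fun _ => ind_le_one _)] at h1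
    rw [ENNReal.toReal_mul] at h2
    field_simp
    linear_combination h1 - h2
  have hev : currentPairSum G Λ θ (starSet ({o} ∆ {x})) ∅ (fun m => ind (¬Conn[m, some o, none])) =
      currentPairSum G Λ θ (starSet ({o} ∆ {x})) ∅ (fun m => ind (¬Conn[m, some o, none] ∧ ¬Conn[m, some o, none])) :=
    currentPairSum_congr fun _ _ _ _ => ind_congr (and_self_iff.symm)
  rw [hrepr, hev, h]
  have hset : (Λ.powerset.filter fun S' => o ∈ S' ∧ x ∈ S' ∧ o ∈ S' ∧ o ∈ S') =
      Λ.powerset.filter (fun S' => o ∈ S' ∧ x ∈ S') := filter_congr fun S' _ => by tauto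
  rw [hset]
  refine sum_congr rfl fun S' _ => ?_
  rw [corrIn, corrIn, thetaCorr_empty, mul_one]

/-! ### Switching identities in real form -/

/-- **The three-point switching identity**: for `x, u, l ∈ Λ`,
`Z⁻² ∑_{∂n₁ = ({x}∆{u})*, ∂n₂ = ∅} w w 𝟙[x ⟷ l] = ⟨σ_uσ_l⟩_θ ⟨σ_xσ_l⟩_θ` (switching the pair
`{x, l}`; Aizenman–Fernández 1986, proof of Lemma 5.4: "Along the way we used the Switching
Lemma (3.8)"). [cite: AizenmanFernandezJSP1986, §5.1, proof of Lemma 5.4] -/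
theorem pairSum_conn_toReal_eq {θ : Sym2 (Option V) → ℝ} (hθ : ∀ e, 0 ≤ θ e) {x u l : V} (hx : x ∈ Λ)
    (hu : u ∈ Λ) (hl : l ∈ Λ) :
    (currentPairSum G Λ θ (starSet ({x} ∆ {u})) ∅ (fun m => ind Conn[m, some x, some l])).toReal /
        (Zg[θ, ∅]).toReal ^ 2 =
      thetaCorr G Λ θ ({u} ∆ {l}) * thetaCorr G Λ θ ({x} ∆ {l}) := by
  have hul : ({u} ∆ {l} : Finset V) ⊆ Λ :=
    symmDiff_le_sup.trans (sup_le (singleton_subset_iff.2 hu) (singleton_subset_iff.2 hl))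
  have hxl : ({x} ∆ {l} : Finset V) ⊆ Λ :=
    symmDiff_le_sup.trans (sup_le (singleton_subset_iff.2 hx) (singleton_subset_iff.2 hl))
  have hsw : currentPairSum G Λ θ (starSet ({x} ∆ {u})) ∅ (fun m => ind Conn[m, some x, some l]) =
      Zg[θ, starSet ({u} ∆ {l})] * Zg[θ, starSet ({x} ∆ {l})] := by
    rw [← currentPairSum_one, starSet_pair, starSet_pair, starSet_pair]
    have h0 : ({some u} ∆ {some l} : Finset (Option V)) = ({some x} ∆ {some u}) ∆ ({some x} ∆ {some l}) := by
      rw [← symmDiff_assoc, symmDiff_comm ({some x} : Finset (Option V)) {some u}, symmDiff_assoc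
        ({some u} : Finset (Option V)), symmDiff_self, symmDiff_bot]
    rw [h0, currentPairSum_switching hθ]
    exact currentPairSum_congr fun _ _ _ _ => by rw [one_mul]
  rw [hsw, ENNReal.toReal_mul, thetaCorr_eq_gcurrentZ_div hθ hul, thetaCorr_eq_gcurrentZ_div hθ hxl]
  have hZpos : 0 < (Zg[θ, ∅]).toReal := toReal_gcurrentZ_ghost_empty_pos subset_rfl hθ subset_rfl
  field_simp

/-- **The cluster-of-`o` weight of `{g ∈ 𝒮_o, k ∉ 𝒮_o}` as a switched pair sum**: for
`o, x, k ∈ Λ`,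
`∑_{S: g ∈ S, k ∉ S} clusterWeight o x S = Z⁻² ∑_{∂n₁ = ({o}∆{k})*, ∂n₂ = ({x}∆{k})*} w w 𝟙[o ↮ g, x ↮ g]`
(switch the pair `{x, k}`: on `∂n₁ = ({o}∆{x})*`, `o ⟷ k ⟺ x ⟷ k`; Aizenman–Fernández 1986, the
step (5.25): "In the last step we used the switching lemma (3.8) and (5.1)"). [cite: AizenmanFernandezJSP1986, §5.2, proof of Thm. 5.6, eq. (5.25)] -/
theorem sum_clusterWeight_notMem_eq_pairSum {θ : Sym2 (Option V) → ℝ} (hθ : ∀ e, 0 ≤ θ e) {o x k : V}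
    (hx : x ∈ Λ) (hk : k ∈ Λ) :
    ∑ S ∈ (Λg).powerset.filter (fun S => (none : Option V) ∈ S ∧ (some k : Option V) ∉ S),
        clusterWeight G Λ θ o x S =
      (currentPairSum G Λ θ (starSet ({o} ∆ {k})) (starSet ({x} ∆ {k}))
          (fun m => ind (¬Conn[m, some o, none] ∧ ¬Conn[m, some x, none]))).toReal / (Zg[θ, ∅]).toReal ^ 2 := by
  unfold clusterWeight
  rw [← sum_div, ← ENNReal.toReal_sum (fun S _ => currentPairSum_ne_top hθ _ _ fun _ => ind_le_one _),
    ← currentPairSum_ind_mem_eq_sum]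
  congr 2
  -- identify the event and switch the pair `{x, k}`
  have hev : currentPairSum G Λ θ (starSet ({o} ∆ {x})) ∅
        (fun m => ind (𝒮[m, some o] ∈ (Λg).powerset.filter (fun S => (none : Option V) ∈ S ∧ (some k : Option V) ∉ S))) =
      currentPairSum G Λ θ (starSet ({o} ∆ {x})) ∅
        (fun m => ind (¬Conn[m, some o, none]) * ind Conn[m, some x, some k]) := by
    refine currentPairSum_congr fun n₁ n₂ h1 _ => ?_
    rw [← ind_and]
    refine ind_congr ?_
    rw [mem_filter, mem_powerset, none_mem_clusterCompl_iff, some_mem_clusterCompl_iff hk, not_not]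
    have hconn : Conn[n₁ + n₂, some o, some x] := by
      by_cases hox : o = x
      · subst hox; exact Relation.ReflTransGen.refl
      · have hsrc : ∂g n₁ = ({some o} ∆ {some x} : Finset (Option V)) := by rw [h1, starSet_pair]
        exact (cconn_of_csources_eq (fun h => hox (Option.some_injective _ h)) hsrc).mono
          fun e => Nat.le_add_right _ _
    constructor
    · rintro ⟨-, hog, hok⟩
      exact ⟨hog, hconn.symm.trans hok⟩
    · rintro ⟨hog, hxk⟩
      exact ⟨clusterCompl_subset _ _, hog, hconn.trans hxk⟩
  rw [hev]
  have hsw : currentPairSum G Λ θ (starSet ({o} ∆ {k})) (starSet ({x} ∆ {k}))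
        (fun m => ind (¬Conn[m, some o, none] ∧ ¬Conn[m, some x, none])) =
      currentPairSum G Λ θ (starSet ({o} ∆ {x})) ∅
        (fun m => ind (¬Conn[m, some o, none] ∧ ¬Conn[m, some x, none]) * ind Conn[m, some x, some k]) := by
    rw [starSet_pair, starSet_pair, starSet_pair]
    have h0 : ({some o} ∆ {some k} : Finset (Option V)) = ({some o} ∆ {some x}) ∆ ({some x} ∆ {some k}) := by
      rw [symmDiff_assoc, ← symmDiff_assoc ({some x} : Finset (Option V)), symmDiff_self, bot_symmDiff]
    rw [h0, currentPairSum_switching hθ]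
  rw [hsw]
  refine currentPairSum_congr fun n₁ n₂ h1 _ => ?_
  by_cases hxk : Conn[n₁ + n₂, some x, some k]
  · rw [ind_of_true hxk, mul_one, mul_one]
    refine ind_congr ⟨fun hog => ⟨hog, fun hxg => hog ?_⟩, fun h => h.1⟩
    have hconn : Conn[n₁ + n₂, some o, some x] := by
      by_cases hox : o = x
      · subst hox; exact Relation.ReflTransGen.refl
      · have hsrc : ∂g n₁ = ({some o} ∆ {some x} : Finset (Option V)) := by rw [h1, starSet_pair]
        exact (cconn_of_csources_eq (fun h => hox (Option.some_injective _ h)) hsrc).mono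
          fun e => Nat.le_add_right _ _
    exact hconn.trans hxg
  · rw [ind_of_false hxk, mul_zero, mul_zero]

/-- **The weight of `{o ↮ g, o ⟷ k}` resolved over the `h`-cluster** (Aizenman–Fernández 1986,
(5.25) with (5.1)): for `o, x, k ∈ Λ`,
`∑_{S: g ∈ S, k ∉ S} clusterWeight o x S = ∑_{S' ⊆ Λ: o,x,k ∈ S'} hclusterWeight S' ⟨σ_oσ_k⟩_{S',0} ⟨σ_xσ_k⟩_{S',0}`. [cite: AizenmanFernandezJSP1986, §5.2, proof of Thm. 5.6, eq. (5.25)] -/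
theorem sum_clusterWeight_notMem_eq_sum_hcluster {θ : Sym2 (Option V) → ℝ} (hθ : ∀ e, 0 ≤ θ e) {o x k : V}
    (ho : o ∈ Λ) (hx : x ∈ Λ) (hk : k ∈ Λ) :
    ∑ S ∈ (Λg).powerset.filter (fun S => (none : Option V) ∈ S ∧ (some k : Option V) ∉ S),
        clusterWeight G Λ θ o x S =
      ∑ S' ∈ Λ.powerset.filter (fun S' => o ∈ S' ∧ k ∈ S' ∧ x ∈ S'),
        hclusterWeight G Λ θ S' * (corrIn G Λ θ (S'.map Function.Embedding.some) ({o} ∆ {k}) *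
          corrIn G Λ θ (S'.map Function.Embedding.some) ({x} ∆ {k})) := by
  rw [sum_clusterWeight_notMem_eq_pairSum hθ hx hk, pairSum_hcluster_eq_sum hθ ho hk hx hk]
  have hset : (Λ.powerset.filter fun S' => o ∈ S' ∧ k ∈ S' ∧ x ∈ S' ∧ k ∈ S') =
      Λ.powerset.filter (fun S' => o ∈ S' ∧ k ∈ S' ∧ x ∈ S') := filter_congr fun S' _ => by tauto
  rw [hset]

/-! ### Depleted systems: isolated sites and the zero-field domination -/

/-- The sources of a current supported on the edges inside `T` lie in `T`. [folklore] -/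
theorem csources_subset_of_csupp_in {T : Finset (Option V)} {n : Eg → ℕ}
    (hs : CSupp Gg Λg (edgesIn Gg T) n) : ∂g n ⊆ T := by
  intro v hv
  have hodd : Odd (cdeg Gg Λg n v) := (mem_filter.1 hv).2
  have hne : cdeg Gg Λg n v ≠ 0 := fun h => by rw [h] at hodd; exact (Nat.not_odd_zero hodd).elim
  obtain ⟨e, -, he⟩ := Finset.exists_ne_zero_of_sum_ne_zero hne
  have hve : v ∈ (e : Sym2 (Option V)) := by
    by_contra h; rw [if_neg h] at he; exact he rfl
  have hne' : n e ≠ 0 := by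
    intro h0; rw [if_pos hve, h0] at he; exact he rfl
  exact (mem_edgesIn_iff.1 (hs e hne')).2 v hve

/-- Current sums inside `T` with a source outside `T` vanish. [folklore] -/
theorem gcurrentZ_in_eq_zero_of_not_subset (θ : Sym2 (Option V) → ℝ) {T X : Finset (Option V)} (h : ¬X ⊆ T) :
    ZIn[θ, T, X] = 0 := by
  unfold gcurrentZ
  refine ENNReal.tsum_eq_zero.2 fun n => ?_
  rw [ind_of_false, zero_mul]
  rintro ⟨hsrc, hs⟩
  exact h (hsrc ▸ csources_subset_of_csupp_in hs)

/-- **A site outside the retained region is isolated and fieldless**: `⟨σ_v⟩_S = 0` for `v ∈ Λ`,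
`v ∉ S` (Aizenman–Fernández 1986, remark after Lemma 3.2: "if there exists `a ∈ B` visited by
bonds of `C(p)` … then `⟨σ_B⟩_{C^c} = 0`"). [cite: AizenmanFernandezJSP1986, §3.3, remark after Lemma 3.2] -/
theorem corrIn_singleton_eq_zero {θ : Sym2 (Option V) → ℝ} (hθ : ∀ e, 0 ≤ θ e) {S : Finset (Option V)}
    (hS : S ⊆ Λg) {v : V} (hv : v ∈ Λ) (hvS : (some v : Option V) ∉ S) : corrIn G Λ θ S {v} = 0 := by
  rw [corrIn_eq_gcurrentZ_div hθ hS (singleton_subset_iff.2 hv), gcurrentZ_in_eq_zero_of_not_subset,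
    ENNReal.toReal_zero, zero_div]
  rw [starSet_singleton]
  intro hsub
  exact hvS (hsub (mem_symmDiff.2 (Or.inl ⟨mem_singleton_self _, fun h =>
    Option.some_ne_none v (mem_singleton.1 h)⟩)))

/-- **Pair correlations vanish across the boundary of the retained region**: `⟨σ_aσ_b⟩_S = 0` for
`a, b ∈ Λ`, `a ≠ b`, `b ∉ S`. [cite: AizenmanFernandezJSP1986, §3.3, remark after Lemma 3.2] -/
theorem corrIn_pair_eq_zero {θ : Sym2 (Option V) → ℝ} (hθ : ∀ e, 0 ≤ θ e) {S : Finset (Option V)}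
    (hS : S ⊆ Λg) {a b : V} (ha : a ∈ Λ) (hb : b ∈ Λ) (hab : a ≠ b) (hbS : (some b : Option V) ∉ S) :
    corrIn G Λ θ S ({a} ∆ {b}) = 0 := by
  have hsub : ({a} ∆ {b} : Finset V) ⊆ Λ :=
    symmDiff_le_sup.trans (sup_le (singleton_subset_iff.2 ha) (singleton_subset_iff.2 hb))
  rw [corrIn_eq_gcurrentZ_div hθ hS hsub, gcurrentZ_in_eq_zero_of_not_subset, ENNReal.toReal_zero, zero_div]
  rw [starSet_pair]
  intro h
  have : (some b : Option V) ∈ ({some a} ∆ {some b} : Finset (Option V)) := by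
    rw [mem_symmDiff]; right
    exact ⟨mem_singleton_self _, fun h' => hab (Option.some_injective _ (mem_singleton.1 h')).symm⟩
  exact hbS (h this)

/-- The `θ`-state only depends on the couplings on the edges `ℰ⁺_Λ` of the ghost graph. [folklore] -/
theorem thetaExpect_congr {θ θ' : Sym2 (Option V) → ℝ} (h : ∀ e ∈ Eg, θ e = θ' e) (f : SpinConfig V → ℝ) :
    thetaExpect G Λ θ f = thetaExpect G Λ θ' f := by
  have hcpl : ∀ i ∈ isingIdx G Λ, thetaCpl G Λ θ i = thetaCpl G Λ θ' i := by
    rintro (e | x) hi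
    · simp only [thetaCpl]
      split_ifs with he
      · exact h _ (map_liftEdge_subset_edgesIn (G := G) (Λ := Λ) subset_rfl (mem_map_of_mem _ he))
      · rfl
    · rw [isingIdx, Finset.inr_mem_disjSum] at hi
      exact h _ (map_ghostEdge_subset_edgesIn (G := G) (Λ := Λ) subset_rfl (mem_map_of_mem _ hi))
  have hw : ∀ τ : SpinConfig ↥Λ, gksWeight (isingIdx G Λ) (thetaCpl G Λ θ) (isingSupp Λ) τ =
      gksWeight (isingIdx G Λ) (thetaCpl G Λ θ') (isingSupp Λ) τ := by
    intro τ
    rw [gksWeight, gksWeight, gksHamiltonian, gksHamiltonian]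
    congr 1
    exact sum_congr rfl fun i hi => by rw [hcpl i hi]
  rw [thetaExpect_eq_sum_div, thetaExpect_eq_sum_div]
  simp only [hw]

/-- `⟨σ_A⟩_θ` only depends on `θ` on `ℰ⁺_Λ`. [folklore] -/
theorem thetaCorr_congr {θ θ' : Sym2 (Option V) → ℝ} (h : ∀ e ∈ Eg, θ e = θ' e) (A : Finset V) :
    thetaCorr G Λ θ A = thetaCorr G Λ θ' A :=
  thetaExpect_congr h _

/-- **Inside a region of real vertices the depleted system carries no field, and is dominated by
the zero-field system on all of `Λ`**: `⟨σ_A⟩_{S',0} ≤ ⟨σ_A⟩_{θ, h=0}` for `S' ⊆ Λ`, `A ⊆ Λ`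
(Aizenman–Fernández 1986, (5.10), (5.25), (5.49): "`⟨σ_zσ_k⟩_{C(h)^c} ≤ ⟨σ_zσ_k⟩_{h=0}`"). [cite: AizenmanFernandezJSP1986, §5.1, proof of Prop. 5.2, eq. (5.10)] -/
theorem corrIn_map_le_zeroField {θ : Sym2 (Option V) → ℝ} (hθ : ∀ e, 0 ≤ θ e) (S' : Finset V) {A : Finset V}
    (hA : A ⊆ Λ) : corrIn G Λ θ (S'.map Function.Embedding.some) A ≤ thetaCorr G Λ (zeroField θ) A := by
  set D := Eg \ edgesIn Gg (S'.map Function.Embedding.some) with hD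
  set θ'' : Sym2 (Option V) → ℝ := fun e => if e ∈ Eg then cplOff θ D e else 0 with hθ''
  have hcongr : corrIn G Λ θ (S'.map Function.Embedding.some) A = thetaCorr G Λ θ'' A :=
    thetaCorr_congr (fun e he => by rw [hθ'']; simp only [he, if_true, hD]) A
  rw [hcongr]
  refine thetaCorr_mono (fun e => ?_) (fun e => ?_) hA
  · simp only [hθ'']
    split_ifs
    · exact cplOff_nonneg hθ _ _
    · exact le_rfl
  · simp only [hθ'']
    by_cases hE : e ∈ Eg
    · rw [if_pos hE]
      unfold cplOff zeroField
      by_cases hn : (none : Option V) ∈ e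
      · rw [if_pos hn, if_pos]
        refine mem_sdiff.2 ⟨hE, fun hin => ?_⟩
        obtain ⟨-, hmem⟩ := mem_edgesIn_iff.1 hin
        obtain ⟨t, -, ht⟩ := mem_map.1 (hmem none hn)
        exact Option.some_ne_none t ht
      · rw [if_neg hn]
        split_ifs
        · exact hθ e
        · exact le_rfl
    · rw [if_neg hE]
      exact zeroField_nonneg hθ e

end Lexicon

end Literature.Probability.LatticeModels
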